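/-
Origin: expansion seat `planner-pub-hodgecm-pv09-g3-0`, handover (14) v3 2026-08-18T06:33:11Z (`HOME/pub-hodgecm-pv09-g3/lean/Pv09g3/NonsplitWitness.lean`, md5 e83bb3b0, 187 lines);
landed by the gen-7 packager in gate run 25 as `HodgeCM/PerL34/NonsplitWitness.lean` (import ^import Pv[0-9]+g[0-9]+\.→import HodgeCM.PerL34. ×1).
-/
/-
Copyright: HodgeCM publication cell (pub-hodgecm), DAG node N31 — seam (I) / S3 (prover pv09, gen 3).
Released under the package licence.

# Honest inhabitation of the unramified place data: the all-non-split regime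

Source under adjudication (NOT cited): PerL v5, Lemma 4.2(b) proof, tex ll. 627–631 (at a non-split
finite place `U(W_i)(L_{0,v})` is compact and equals its maximal compact subgroup, `I_v = 1`).

This file is a VACUITY DEFENCE for the S3 package of this seat: the per-place structure
`PureTensor.UnramifiedPlaceData` (CanonicalPieces.lean) is INHABITED, with no input at all, in the
regime where every place off `S` is non-split (`B_i = G_i` off `S`), and the end theorem then reads
`θ ≠ 0` with NO per-place hypothesis off `S` and NO number-field input:

* instances `isHaarMeasure_haarDatum_ν`, `isMulLeftInvariant_haarDatum_ν` (the local measures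
  of `haarDatum` are Haar / left-invariant — the typeclass pv13-g3's `SplitShells` consumes);
* `integrable_localCoeff_haarDatum_of_compactSpace` — the bad-place hypothesis `hclS` is automatic
  at compact `G_i` (finite Haar measure + local continuity; item 4);
* `summable_tOf_of_countable` — on a countable index type there is `q ≥ 2` with `Σ q_i^{-3/2} < ∞`
  (an injection into `ℕ`, shifted by `2`; `Real.summable_nat_rpow`);
* `UnramifiedPlaceData.ofNonsplit` — the data with `IsSplit := False`, empty shells, `χ_ϖ = ν_ϖ = 1`;
* `theta_ne_zero_levels` — the end theorem of `CharContinuity.lean` with `summable_t` as a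
  hypothesis (rather than number-field places);
* `theta_ne_zero_nonsplit` — **all places off `S` non-split**: `θ ≠ 0` from the representation
  side (`‖φ‖ = 1`, `hK`, `hM`, `hN31e`, local continuity), the character (level + local continuity),
  `hnorm`, `0 < c`, the compact fundamental domain and the finitely many bad-place facts ONLY.

Mathlib + this seat's files only; nothing cited; no hypothesis names PerL, QW8 or a 2001-programme
claim.  Axioms: the standard trio.  Unit `pub-hodgecm-pv09-g3`, 2026-08-18.
-/
import Summits.HodgeConjecture.HodgeCM.PerL34.CharContinuity
import Mathlib.Analysis.PSeries

set_option autoImplicit false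

noncomputable section

open MeasureTheory Filter Topology
open scoped RestrictedProduct InnerProductSpace

namespace HodgeCM.PerL34.PureTensor

open HodgeCM.PerL34.AdelicFactorisation HodgeCM.PerL34.RestrictedMeasure
  HodgeCM.PerL34.NoSmallSubgroups HodgeCM.PerL34.EulerFactorisation

/-! ## §0 Instances: the local measures of the Haar datum are Haar measures

(pv13-g3's `SplitShells.SplitPlaceModel.hvol` / `unramifiedPlaceDataOfModels` ask for
`[(D.ν i).IsMulLeftInvariant]`; for `D = haarDatum B hBc hBo S₀` this is the instance below.) -/

section instances

variable {ι : Type} {G : ι → Type} [∀ i, CommGroup (G i)] [∀ i, TopologicalSpace (G i)]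
  [∀ i, IsTopologicalGroup (G i)] [∀ i, T2Space (G i)] [∀ i, SecondCountableTopology (G i)]
  [∀ i, LocallyCompactSpace (G i)] [∀ i, MeasurableSpace (G i)] [∀ i, BorelSpace (G i)]
  [Countable ι]
  (B : ∀ i, Subgroup (G i)) (hBc : ∀ i, IsCompact (B i : Set (G i)))
  (hBo : ∀ i, IsOpen (B i : Set (G i)))

/-- (Ported verbatim from the HodgeCMPerL package; no docstring in the source.) -/
instance isHaarMeasure_haarDatum_ν (S₀ : Finset ι) (i : ι) :
    ((haarDatum B hBc hBo S₀).ν i).IsHaarMeasure := by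
  rw [haarDatum_ν]; infer_instance

/-- (Ported verbatim from the HodgeCMPerL package; no docstring in the source.) -/
instance isMulLeftInvariant_haarDatum_ν (S₀ : Finset ι) (i : ι) :
    ((haarDatum B hBc hBo S₀).ν i).IsMulLeftInvariant := by
  rw [haarDatum_ν]; infer_instance

omit [∀ i, LocallyCompactSpace (G i)] in
/-- **`hclS` is automatic at COMPACT bad places**: on a compact `G_i` the local measure of the Haar
datum is finite, so the local coefficient is integrable as soon as the local orbit map is continuous
(item 4's `integrable_localCoeff_of_isFiniteMeasure`).  Only the non-compact places of `S` (split
ramified / archimedean-type factors) need a genuine decay estimate (N31f). -/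
theorem integrable_localCoeff_haarDatum_of_compactSpace [DecidableEq ι] (S₀ : Finset ι)
    {Sp : Type} [NormedAddCommGroup Sp] [InnerProductSpace ℂ Sp]
    (ω : (Πʳ j, [G j, B j]) →* (Sp ≃ₗᵢ[ℂ] Sp)) (φ : Sp) {i : ι} [CompactSpace (G i)]
    (hloc : Continuous fun g : G i => ω (RestrictedProduct.mulSingle B i g) φ) :
    Integrable (localCoeff B ω φ i) ((haarDatum B hBc hBo S₀).ν i) :=
  integrable_localCoeff_of_isFiniteMeasure B ω φ _ hloc

end instances

/-! ## §1 A summable `q`-family on any countable index type -/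

/-- On a countable type there is a family `q ≥ 2` of natural numbers with `Σ_i q_i^{-3/2} < ∞`
(restricted to any subtype). -/
theorem summable_tOf_of_countable (ι : Type) [Countable ι] (p : ι → Prop) :
    ∃ q : ι → ℕ, (∀ i, 2 ≤ q i) ∧ Summable fun i : {j : ι // p j} => EulerProduct.tOf (q i.1) := by
  obtain ⟨f, hf⟩ := Countable.exists_injective_nat ι
  refine ⟨fun i => f i + 2, fun i => Nat.le_add_left 2 (f i), ?_⟩
  have h1 : Summable fun n : ℕ => EulerProduct.tOf (n + 2) := by
    have h := (summable_nat_add_iff (f := fun n : ℕ => ((n : ℝ) ^ (-(3 / 2 : ℝ)))) 2).2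
      (Real.summable_nat_rpow.2 (by norm_num))
    refine h.congr fun n => ?_
    simp only [EulerProduct.tOf, Nat.cast_add, Nat.cast_ofNat]
  have hinj : Function.Injective fun i : {j : ι // p j} => f i.1 :=
    fun a b h => Subtype.ext (hf h)
  exact h1.comp_injective hinj

/-! ## §2 The all-non-split unramified data -/

section nonsplit

variable {ι : Type} {G : ι → Type} [∀ i, CommGroup (G i)] [∀ i, MeasurableSpace (G i)]
  [∀ i, MeasurableInv (G i)]
  {Sub : ι → Type*} [∀ i, SetLike (Sub i) (G i)] [∀ i, SubgroupClass (Sub i) (G i)]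
  (B : ∀ i, Sub i) [DecidableEq ι]
  {Sp : Type} [NormedAddCommGroup Sp] [InnerProductSpace ℂ Sp]

/-- **The unramified place data when every place off `S` is non-split** (`B_i = G_i`,
`ν_i(G_i) = 1`): no shells, no model identity, `χ_ϖ = ν_ϖ = 1`. -/
def UnramifiedPlaceData.ofNonsplit (D : RestrictedProductMeasureDatum ι G (Πʳ j, [G j, B j]))
    [∀ i, (D.ν i).IsInvInvariant] (ω : (Πʳ j, [G j, B j]) →* (Sp ≃ₗᵢ[ℂ] Sp)) (φ : Sp)
    (χ : (Πʳ j, [G j, B j]) →* Circle) (S : Finset ι) (q : ι → ℕ) (hq : ∀ i, i ∉ S → 2 ≤ q i)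
    (hB : ∀ i, i ∉ S → (B i : Set (G i)) = Set.univ) (hν : ∀ i, i ∉ S → D.ν i Set.univ = 1) :
    UnramifiedPlaceData B D ω φ χ S q (fun _ => 1) (fun _ => 1) (fun _ => False) where
  P := fun _ _ => ∅
  hm := fun _ _ h => h.elim
  hd := fun _ _ h => h.elim
  hcover := fun _ _ h => h.elim
  hvol := fun _ _ h => h.elim
  hF := fun _ _ h => h.elim
  hBi := fun i hi _ => hB i hi
  hν1 := fun i hi _ => hν i hi
  two_le_q := hq
  chi_norm := fun _ _ => by simp
  nu_norm := fun _ _ => by simp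

end nonsplit

/-! ## §3 The end theorem with `summable_t` as a hypothesis, and the all-non-split case -/

section levels

open ComplexConjugate

variable {ι : Type} {G : ι → Type} [∀ i, CommGroup (G i)] [∀ i, TopologicalSpace (G i)]
  [∀ i, IsTopologicalGroup (G i)] [∀ i, T2Space (G i)] [∀ i, SecondCountableTopology (G i)]
  [∀ i, LocallyCompactSpace (G i)] [∀ i, MeasurableSpace (G i)] [∀ i, BorelSpace (G i)]
  [Countable ι] [DecidableEq ι]
  (B : ∀ i, Subgroup (G i)) (hBc : ∀ i, IsCompact (B i : Set (G i)))
  (hBo : ∀ i, IsOpen (B i : Set (G i))) (S₀ : Finset ι)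
  {Sp : Type} [NormedAddCommGroup Sp] [InnerProductSpace ℂ Sp]
  {E : Type*} [NormedAddCommGroup E] [InnerProductSpace ℂ E]
  (ω : (Πʳ j, [G j, B j]) →* (Sp ≃ₗᵢ[ℂ] Sp)) (φ : Sp) (hφ : ‖φ‖ = 1)
  (hloc : ∀ (i : ι) (v : Sp), Continuous fun g : G i => ω (RestrictedProduct.mulSingle B i g) v)
  (χ : (Πʳ j, [G j, B j]) →* Circle) {T' : Finset ι}
  (hχT' : RestrictedProduct.boxSubgroup B T' ≤ χ.ker)
  (hlocχ : ∀ i ∈ T', Continuous fun g : G i => χ (RestrictedProduct.mulSingle B i g))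
  (𝓕 : Set (Πʳ j, [G j, B j])) (h𝓕c : IsCompact 𝓕) (h𝓕i : (interior 𝓕).Nonempty)
  (K : (Πʳ j, [G j, B j]) → (Πʳ j, [G j, B j]) → ℂ) (c : ℝ) (c_pos : 0 < c) (θ : E) (Θ : Set E)
  (hθ : θ ∈ Θ)
  (hN31e : RallisIP.N31e_statement (haarDatum B hBc hBo S₀).μ 𝓕 ω φ
    (fun y => ((χ y : Circle) : ℂ)) K (c : ℂ))
  (hnorm : ⟪θ, θ⟫_ℂ = ∫ u in 𝓕, ∫ u' in 𝓕, ((χ u : Circle) : ℂ) * conj ((χ u' : Circle) : ℂ) *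
    K u u' ∂(haarDatum B hBc hBo S₀).μ ∂(haarDatum B hBc hBo S₀).μ)
  {T : Finset ι} (hK : ∀ k ∈ RestrictedProduct.boxSubgroup B T, ω k φ = φ)
  (hM : ∀ S : Finset ι, T ⊆ S → ∀ y : (i : ↥S) → G i,
    inner ℂ φ (ω (extendOne B S y) φ) = ∏ i : ↥S, localCoeff B ω φ i (y i))
  {S : Finset ι}
  (hTS : T ⊆ S) (hT'S : T' ⊆ S)
  (hclS : ∀ i ∈ S, Integrable (localCoeff B ω φ i) ((haarDatum B hBc hBo S₀).ν i))
  (ram_pos : ∀ i ∈ S, 0 < (localIntegrand B (haarDatum B hBc hBo S₀) ω φ χ i).I)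

include hφ hloc hχT' hlocχ h𝓕c h𝓕i c_pos hθ hN31e hnorm hK hM hTS hT'S hclS ram_pos

/-- The end theorem of `CharContinuity.lean` with `summable_t` as a hypothesis. -/
theorem theta_ne_zero_levels {q : ι → ℕ} {chiPi nuPi : ι → ℂ} {IsSplit : ι → Prop}
    (X : UnramifiedPlaceData B (haarDatum B hBc hBo S₀) ω φ χ S q chiPi nuPi IsSplit)
    (hsum : Summable fun i : {j : ι // j ∉ S} => EulerProduct.tOf (q i.1)) : θ ≠ 0 :=
  theta_ne_zero_local B hBc hBo S₀ ω φ hφ hloc χ (continuous_char B hBo χ hχT' hlocχ) 𝓕 h𝓕c h𝓕i K c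
    c_pos θ Θ hθ hN31e hnorm hK hχT' hM X hTS hT'S hclS ram_pos hsum

/-- **All places off `S` non-split: `θ ≠ 0` with NO per-place input off `S`.**  (The structure
`UnramifiedPlaceData` and the S3 end theorem are honestly inhabited / non-vacuous.) -/
theorem theta_ne_zero_nonsplit (hB : ∀ i, i ∉ S → (B i : Set (G i)) = Set.univ) : θ ≠ 0 := by
  obtain ⟨q, hq, hsum⟩ := summable_tOf_of_countable ι (fun j => j ∉ S)
  have hν : ∀ i, i ∉ S → (haarDatum B hBc hBo S₀).ν i Set.univ = 1 := fun i hi => by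
    rw [← hB i hi]
    exact haarDatum_ν_self B hBc hBo S₀ i
  exact theta_ne_zero_levels B hBc hBo S₀ ω φ hφ hloc χ hχT' hlocχ 𝓕 h𝓕c h𝓕i K c c_pos θ Θ hθ hN31e
    hnorm hK hM hTS hT'S hclS ram_pos
    (UnramifiedPlaceData.ofNonsplit B (haarDatum B hBc hBo S₀) ω φ χ S q (fun i hi => hq i) hB hν)
    hsum

end levels

end HodgeCM.PerL34.PureTensor
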